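import Literature.AlgebraicGeometry.Morphisms.ProperGenericFibreDim
import Literature.AlgebraicGeometry.Morphisms.CechH1Projective
import Literature.AlgebraicGeometry.Motives.IntegralProjectiveSpace
import Summits.ResolutionOfSingularities.ResolutionOfSingularities.Theorems.EquisingularLiftEquisingularLiftNatRationalCarrierInfinite
import Summits.ResolutionOfSingularities.ResolutionOfSingularities.Theorems.EquisingularLiftEquisingularLiftNatModelStep
import Summits.ResolutionOfSingularities.ResolutionOfSingularities.Theorems.EquisingularLiftEquisingularLiftNatRegularOfFlatModel
import Summits.ResolutionOfSingularities.ResolutionOfSingularities.Theorems.EquisingularLiftEquisingularLiftNatCarrierDeltaComapFrame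
import Summits.ResolutionOfSingularities.ResolutionOfSingularities.Theorems.EquisingularLiftEquisingularLiftNatCentreCodimTwoAdapters
import Mathlib.RingTheory.KrullDimension.Regular
import Summits.ResolutionOfSingularities.ResolutionOfSingularities.Theorems.EquisingularLiftEquisingularLiftNatF102Integral
import Mathlib.AlgebraicGeometry.ZariskisMainTheorem
import Mathlib.AlgebraicGeometry.Morphisms.QuasiFinite
import HarnessLib

/-!
# [OURS · L1 W4.5(b) · LINE (T-j)-PROOF] BRICK S6 — `φ : C → ℙ¹_O` IS FINITE
# (F-102 `GenusZeroOverCompleteDVR_holds`, res-L1-w45b-lead-2 g3's skeleton `F102Skeleton.lean` v1 ecade93244d6930c, brick S6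
# `isFinite_of_subsingleton_closedFibre`; crux `EquisingularLiftNatThree` = stmt-ResolutionOfSingularities-20148, residue (T-j))

res-D-pv-035 g9 (res-L1-w45b-plan-1 DEAL OF RECORD 2026-08-27T21:34:48Z «S6 wrapper = res-D-pv-035, against the lead's signature, on top of the
(M-b) file»). OURS; NOT a statement of any manuscript; AI-written, weaker than expert review. No `sorry`; standard axioms; DEF-FREE.
`--supports stmt-ResolutionOfSingularities-20148 --as helper`.

WHAT. In the setting of F-102 (`O` a complete DVR with algebraically closed residue field `k`, `θ : O ↠ k`; `f : C → Spec O` proper;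
closed fibre `i : Ck → C` a cartesian square over `Spec θ` with `Ck ≅ ℙ¹_{k'}`) and for a morphism `φ : C → ℙ¹_O` OVER `Spec O` whose fibres
over the closed fibre of `ℙ¹_O` have at most one point (`hinj`) and whose restriction to `Ck` maps ONTO the closed fibre of `ℙ¹_O` (`hsurj`):
**`φ` is finite** — the skeleton's S6 signature (v2 6bba20ad1f5e44a7) plus ONE S0-bookkeeping binder the assembly has anyway: `[IsIntegral C]`
(glue G1 `F102.isIntegral_of_isRegular`, moved before S6). The dimension input «closed points of `C` have `dim 𝒪 = 2`» is DERIVED here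
(glue G0 `ringKrullDim_stalk_eq_two_of_isClosed`, from flatness and `Ck ≅ ℙ¹`).
PROOF. `φ` is proper (`φ ≫ toSpec = f` proper, `toSpec` separated: Mathlib `IsProper.of_comp`), so finite iff quasi-finite (Mathlib's
light Zariski main theorem `IsFinite.of_isProper_of_locallyQuasiFinite`), iff every fibre `φ ⁻¹' {y}` is finite
(`locallyQuasiFinite_iff_finite_preimage_singleton`). Over the closed point: `hinj`. Over the generic point of `Spec O`, `y ≠ φ(η_C)`:
`Literature.AlgebraicGeometry.Morphisms.Set.Finite.preimage_singleton_of_ne_closedPoint` ((M-b): the generic fibre of the proper `O`-surface `C`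
has incomparable points). Over `y = φ(η_C)`: the fibre is `{η_C}` — a second point `x` would have `1 ≤ dim 𝒪_{C,x}`, so `closure {x}` meets the
closed fibre `C_k` in a FINITE set ((M-b) `finite_closure_singleton_inter_closedFibre`), while `φ(C) ⊆ closure {y} ⊆ φ(closure {x})` (`φ` closed)
puts the whole closed fibre `(ℙ¹_O)_k = φ(i(Ck))` (`hsurj`) inside `φ(closure {x} ∩ C_k)`; but `(ℙ¹_O)_k` is infinite (`i ≫ φ` is injective on
points by `hinj`, `Ck ≅ ℙ¹_{k'}` is infinite — res-L1-w45b-lead-2's `infinite_projectiveLine`).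

References (OURS / tree): res-D-pv-035 `Literature/AlgebraicGeometry/Morphisms/ProperGenericFibreDim.lean` ((M-b)); res-L1-w45b-lead-2
`…NatRationalCarrierInfinite` (`infinite_projectiveLine`); res-type-100 `…NatModelStep` (`range_eq_preimage_of_isPullback`,
`range_specMap_of_surjective_of_field`); `Literature.AlgebraicGeometry.Motives.ProjBaseChangeRing.isProper_projToSpec`; Mathlib
`IsFinite.of_isProper_of_locallyQuasiFinite` (Stacks 02LS), `locallyQuasiFinite_iff_finite_preimage_singleton`. [cite: StacksProject, Tag 02LS]
-/

set_option linter.dupNamespace false -- mandated namespace `Summit.<Summit>.<Problem>` of this single-conjunct summit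
set_option linter.overlappingInstances false -- signature carries `[IsDomain O] [IsDiscreteValuationRing O]`

noncomputable section

open CategoryTheory AlgebraicGeometry TopologicalSpace Topology IsLocalRing
open Literature.AlgebraicGeometry.Morphisms Literature.AlgebraicGeometry
open Literature.AlgebraicGeometry.Morphisms (ProjCech.PP ProjCech.toSpec)
open Summit.ResolutionOfSingularities.ResolutionOfSingularities.Cruxes.EquisingularLiftNat.Sections

namespace Summit.ResolutionOfSingularities.ResolutionOfSingularities.Cruxes.EquisingularLiftNat.F102

/-- **G0 — the closed points of `C` have `2`-dimensional local rings.** In the setting of F-102 (`f : C → Spec O` proper and FLAT over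
the DVR `O`, closed fibre `i : Ck → C` cartesian over `Spec θ`, `θ : O ↠ k`, `Ck ≅ ℙ¹_{k'}`): at every CLOSED point `c` of `C`,
`dim 𝒪_{C,c} = 2`. Indeed `c` lies over the closed point (`f` is a closed map), so `c = i z` with `z` closed in `Ck`; the stalk map
`i^♯_z : 𝒪_{C,c} ↠ 𝒪_{Ck,z}` has kernel `(ϖ)` (res-type-100's `ker_stalkMap_model_le` / `stalkMap_model_varpi`), `ϖ` is a non-unit
nonzerodivisor by flatness (`mem_nonZeroDivisors_Γgerm_appTop_of_flat`), so `dim 𝒪_{C,c} = dim 𝒪_{Ck,z} + 1` (Mathlib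
`ringKrullDim_quotient_span_singleton_succ_eq_ringKrullDim_of_mem_nonZeroDivisors`, Stacks 00KW), and `dim 𝒪_{Ck,z} = 1` at a closed point of
`Ck ≅ ℙ¹_{k'}` (res-L1-w45b-stub-3's `ringKrullDim_stalk_eq_of_iso_projectiveSpace`). [cite: StacksProject, Tag 00KW]
[cite: GortzWedhorn2020, Lemma 6.26] [OURS · L1 W4.5b · LINE (T-j)-PROOF glue G0] -/
theorem ringKrullDim_stalk_eq_two_of_isClosed (O : Type) [CommRing O] [IsDomain O] [IsDiscreteValuationRing O]
    (k : Type) [Field k] (θ : O →+* k) (C : Scheme.{0}) (f : C ⟶ Spec (.of O)) [IsProper f] [Flat f]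
    (Ck : Scheme.{0}) (i : Ck ⟶ C) (t : Ck ⟶ Spec (.of k)) (hθ : Function.Surjective θ)
    (hsq : IsPullback i t f (Spec.map (CommRingCat.ofHom θ)))
    (hP1 : ∃ (k' : Type) (_ : Field k'), Nonempty (Ck ≅ ProjCech.PP k' 1))
    (c : C) (hc : IsClosed ({c} : Set C)) :
    ringKrullDim (C.presheaf.stalk c) = ((2 : ℕ) : WithBot ℕ∞) := by
  haveI : IsLocallyNoetherian C := LocallyOfFiniteType.isLocallyNoetherian f
  haveI : IsClosedImmersion (Spec.map (CommRingCat.ofHom θ)) := IsClosedImmersion.spec_of_surjective _ hθ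
  haveI : IsClosedImmersion i := MorphismProperty.IsStableUnderBaseChange.of_isPullback hsq.flip inferInstance
  -- `c = i z` with `z` closed in `Ck`
  have hcr : c ∈ Set.range i := by
    rw [range_eq_preimage_of_isPullback hsq, range_specMap_of_surjective_of_field θ hθ]
    exact apply_eq_closedPoint_of_isClosed_singleton f c hc
  obtain ⟨z, rfl⟩ := hcr
  have hz : IsClosed ({z} : Set Ck) := by
    have h := hc.preimage i.continuous
    have heq : i.base ⁻¹' ({i z} : Set C) = {z} := by
      ext w
      simp only [Set.mem_preimage, Set.mem_singleton_iff]
      exact ⟨fun h => i.isClosedEmbedding.injective h, fun h => by rw [h]⟩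
    rwa [heq] at h
  -- `dim 𝒪_{Ck,z} = 1`
  obtain ⟨k', _, ⟨e⟩⟩ := hP1
  have h1 : ringKrullDim (Ck.presheaf.stalk z) = ((1 : ℕ) : WithBot ℕ∞) := ringKrullDim_stalk_eq_of_iso_projectiveSpace 1 e z hz
  -- the model-square stalk map: kernel `(ϖ)`, `ϖ` a regular non-unit
  obtain ⟨ϖ, hϖ⟩ := IsDiscreteValuationRing.exists_irreducible O
  set S := C.presheaf.stalk (i z) with hS
  set g : S := (C.presheaf.Γgerm (i z)).hom (f.appTop.hom ((Scheme.ΓSpecIso (.of O)).inv.hom ϖ)) with hg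
  have hg0 : g ∈ nonZeroDivisors S := mem_nonZeroDivisors_Γgerm_appTop_of_flat f (i z) hϖ.ne_zero
  have hsurj := stalkMap_model_surjective θ hθ f i t hsq z
  have hker : RingHom.ker (i.stalkMap z).hom = Ideal.span {g} := by
    refine le_antisymm (ker_stalkMap_model_le O k θ hθ f i t hsq z ϖ hϖ) ?_
    rw [Ideal.span_le, Set.singleton_subset_iff, SetLike.mem_coe, RingHom.mem_ker]
    exact stalkMap_model_varpi θ hθ f i t hsq z ϖ (by rw [hϖ.maximalIdeal_eq]; exact Ideal.mem_span_singleton_self ϖ)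
  have hg𝔪 : g ∈ IsLocalRing.maximalIdeal S := by
    rw [IsLocalRing.mem_maximalIdeal, mem_nonunits_iff]
    intro hu
    have h0 : (i.stalkMap z).hom g = 0 := by
      rw [← RingHom.mem_ker, hker]; exact Ideal.mem_span_singleton_self g
    have hu1 := hu.map (i.stalkMap z).hom
    rw [h0] at hu1
    exact not_isUnit_zero hu1
  have e' : S ⧸ Ideal.span {g} ≃+* Ck.presheaf.stalk z :=
    (Ideal.quotEquivOfEq hker.symm).trans (RingHom.quotientKerEquivOfSurjective hsurj)
  have hdim := ringKrullDim_quotient_span_singleton_succ_eq_ringKrullDim_of_mem_nonZeroDivisors hg0 hg𝔪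
  rw [ringKrullDim_eq_of_ringEquiv e', h1] at hdim
  rw [← hdim]
  norm_cast

/-- **BRICK S6 — `φ : C → ℙ¹_O` is finite** (see the module docstring; res-L1-w45b-lead-2's skeleton signature
`isFinite_of_subsingleton_closedFibre` v2 + the S0 binder `[IsIntegral C]`). [cite: StacksProject, Tag 02LS]
[OURS · L1 W4.5b · LINE (T-j)-PROOF brick S6] toward F-102 `GenusZeroOverCompleteDVR_holds` (residue (T-j) of stmt-ResolutionOfSingularities-20148);
NOT a statement of the manuscript. -/
theorem isFinite_of_subsingleton_closedFibre (O : Type) [CommRing O] [IsDomain O] [IsDiscreteValuationRing O]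
    [IsAdicComplete (maximalIdeal O) O] (k : Type) [Field k] [IsAlgClosed k] (θ : O →+* k)
    (C : Scheme.{0}) (f : C ⟶ Spec (.of O)) [IsProper f] [Flat f] (Ck : Scheme.{0}) (i : Ck ⟶ C) (t : Ck ⟶ Spec (.of k))
    [IsIntegral C] (hθ : Function.Surjective θ) (_hreg : Resolution.Scheme.IsRegular C)
    (hsq : IsPullback i t f (Spec.map (CommRingCat.ofHom θ)))
    (hP1 : ∃ (k' : Type) (_ : Field k'), Nonempty (Ck ≅ ProjCech.PP k' 1))
    (φ : C ⟶ ProjCech.PP O 1) (hφ : φ ≫ ProjCech.toSpec O 1 = f)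
    (hinj : ∀ y : ProjCech.PP O 1, ProjCech.toSpec O 1 y = closedPoint O → (φ.base ⁻¹' {y}).Subsingleton)
    (hsurj : Set.range (i ≫ φ).base = (ProjCech.toSpec O 1).base ⁻¹' {closedPoint O}) :
    IsFinite φ := by
  classical
  -- G0: the closed points of `C` have `2`-dimensional local rings
  have hdim2 : ∀ c : C, IsClosed ({c} : Set C) → ringKrullDim (C.presheaf.stalk c) ≤ ((2 : ℕ) : WithBot ℕ∞) :=
    fun c hc => (ringKrullDim_stalk_eq_two_of_isClosed O k θ C f Ck i t hθ hsq hP1 c hc).le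
  -- `C` is locally Noetherian (finite type over the Noetherian `O`) and quasi-compact (proper)
  haveI : IsLocallyNoetherian C := LocallyOfFiniteType.isLocallyNoetherian f
  haveI : CompactSpace C := QuasiCompact.compactSpace_of_compactSpace f
  -- `φ` is proper: `φ ≫ toSpec = f` is proper and `toSpec` is separated
  haveI : IsProper (ProjCech.toSpec O 1) := Motives.ProjBaseChangeRing.isProper_projToSpec (Fin (1 + 1)) O
  haveI : IsProper (φ ≫ ProjCech.toSpec O 1) := by rw [hφ]; infer_instance
  haveI : IsProper φ := IsProper.of_comp φ (ProjCech.toSpec O 1)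
  -- bookkeeping: `f x = toSpec (φ x)`
  have hfx : ∀ x : C, f x = ProjCech.toSpec O 1 (φ x) := fun x => by
    rw [← hφ]; rfl
  -- `dim 𝒪_{C,z} ≤ 2` at EVERY point (generize from a closed specialisation)
  have h2all : ∀ z : C, ringKrullDim (C.presheaf.stalk z) ≤ ((2 : ℕ) : WithBot ℕ∞) := by
    intro z
    obtain ⟨c, hcz, hccl⟩ := (isClosed_closure (s := ({z} : Set C))).exists_closed_singleton ⟨z, subset_closure rfl⟩
    have hzc : z ⤳ c := specializes_iff_mem_closure.mpr hcz
    by_cases hne : z = c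
    · subst hne; exact hdim2 _ hccl
    · exact (Resolution.ringKrullDim_stalk_lt_of_specializes hzc hne).le.trans (hdim2 c hccl)
  -- the closed fibre of `ℙ¹_O` is infinite: `i ≫ φ` is injective on points and `Ck ≅ ℙ¹_{k'}` is infinite
  have hrangei : Set.range i = f ⁻¹' {closedPoint O} := by
    rw [range_eq_preimage_of_isPullback hsq, range_specMap_of_surjective_of_field θ hθ]
  have hinjφ : Function.Injective (i ≫ φ).base := by
    haveI : IsClosedImmersion (Spec.map (CommRingCat.ofHom θ)) := IsClosedImmersion.spec_of_surjective _ hθ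
    haveI : IsClosedImmersion i := MorphismProperty.IsStableUnderBaseChange.of_isPullback hsq.flip inferInstance
    intro a b hab
    have ha : f (i a) = closedPoint O := by
      have h1 : i a ∈ Set.range i := ⟨a, rfl⟩
      rw [hrangei] at h1
      exact h1
    have hy : ProjCech.toSpec O 1 (φ (i a)) = closedPoint O := by rw [← hfx]; exact ha
    have hab' : φ (i a) = φ (i b) := by
      simpa only [Scheme.Hom.comp_base, TopCat.coe_comp, Function.comp_apply] using hab
    have h := hinj (φ (i a)) hy (show i a ∈ φ.base ⁻¹' {φ (i a)} from rfl)
      (show i b ∈ φ.base ⁻¹' {φ (i a)} from hab'.symm)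
    exact i.isClosedEmbedding.injective h
  have hPk_inf : ((ProjCech.toSpec O 1).base ⁻¹' {closedPoint O} : Set (ProjCech.PP O 1)).Infinite := by
    obtain ⟨k', _, ⟨e⟩⟩ := hP1
    haveI : Infinite ↥(ProjCech.PP k' 1) := infinite_projectiveLine k'
    haveI : Infinite ↥Ck := Infinite.of_injective e.inv.base e.inv.isOpenEmbedding.injective
    rw [← hsurj]
    exact Set.infinite_range_of_injective hinjφ
  -- quasi-finiteness, fibre by fibre
  haveI : LocallyQuasiFinite φ := by
    refine locallyQuasiFinite_iff_finite_preimage_singleton.mpr fun y => ?_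
    by_cases hy : ProjCech.toSpec O 1 y = closedPoint O
    · -- over the closed point: at most one point
      exact (hinj y hy).finite
    · -- over the generic point of `Spec O`
      have hyC : ∀ x : C, φ x = y → f x ≠ closedPoint O := by
        intro x hx h
        apply hy
        rw [← hx, ← hfx]; exact h
      by_cases hgen : φ (genericPoint C) = y
      · -- the fibre through the generic point is `{η_C}`
        refine (Set.finite_singleton (genericPoint C)).subset fun x hx => ?_
        have hxy : φ x = y := hx
        by_contra hxne
        have hx1 : (1 : WithBot ℕ∞) ≤ ringKrullDim (C.presheaf.stalk x) := one_le_ringKrullDim_stalk_of_ne_genericPoint x hxne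
        obtain ⟨hfin, -⟩ := finite_closure_singleton_inter_closedFibre f h2all x (hyC x hxy) hx1
        -- `φ(C) ⊆ closure {y} ⊆ φ(closure {x})`
        have hclosed : IsClosed (φ.base '' closure ({x} : Set C)) := φ.isClosedMap _ isClosed_closure
        have hsub1 : closure ({y} : Set (ProjCech.PP O 1)) ⊆ φ.base '' closure ({x} : Set C) :=
          hclosed.closure_subset_iff.mpr (Set.singleton_subset_iff.mpr ⟨x, subset_closure rfl, hxy⟩)
        have hsub2 : Set.range φ.base ⊆ closure ({y} : Set (ProjCech.PP O 1)) := by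
          rintro _ ⟨c, rfl⟩
          have hc : c ∈ closure ({genericPoint C} : Set C) := by rw [genericPoint_closure]; trivial
          have h1 := image_closure_subset_closure_image φ.continuous ⟨c, hc, rfl⟩
          rwa [Set.image_singleton, hgen] at h1
        -- hence the closed fibre of `ℙ¹_O` lies in `φ(closure {x} ∩ C_k)`, a finite set
        have hPk_sub : ((ProjCech.toSpec O 1).base ⁻¹' {closedPoint O} : Set (ProjCech.PP O 1)) ⊆
            φ.base '' (closure ({x} : Set C) ∩ f ⁻¹' {closedPoint O}) := by
          intro p hp
          have hp' : p ∈ Set.range (i ≫ φ).base := by rw [hsurj]; exact hp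
          obtain ⟨a, rfl⟩ := hp'
          have hpa : (i ≫ φ).base a = φ (i a) := by
            simp only [Scheme.Hom.comp_base, TopCat.coe_comp, Function.comp_apply]
          rw [hpa] at hp ⊢
          obtain ⟨x', hx', hx'eq⟩ := hsub1 (hsub2 ⟨i a, rfl⟩)
          refine ⟨x', ⟨hx', ?_⟩, hx'eq⟩
          show f x' = closedPoint O
          rw [hfx, hx'eq]; exact hp
        exact hPk_inf ((hfin.image φ.base).subset hPk_sub)
      · exact Set.Finite.preimage_singleton_of_ne_closedPoint f hdim2 φ y hyC hgen
  exact IsFinite.of_isProper_of_locallyQuasiFinite φ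

/-- **BRICK S6, skeleton v3 signature VERBATIM** (res-L1-w45b-lead-2's `F102Skeleton.lean` v3 1683bb741349c142, l.«isFinite_of_subsingleton_closedFibre»;
the ASSEMBLY calls S6 before it establishes `IsIntegral C`): the same finiteness with `IsIntegral C` supplied IN-TERM by glue G1
(`F102.isIntegral_of_isRegular`, p575507). Use this name in the assembly for a zero-edit call: `isFinite_of_subsingleton_closedFibre_v3 O k θ C f
Ck i t hθ hreg hsq hP1 φ hφ hinj hsurj`. [cite: StacksProject, Tag 02LS] [OURS · L1 W4.5b · LINE (T-j)-PROOF brick S6] -/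
theorem isFinite_of_subsingleton_closedFibre_v3 (O : Type) [CommRing O] [IsDomain O] [IsDiscreteValuationRing O]
    [IsAdicComplete (maximalIdeal O) O] (k : Type) [Field k] [IsAlgClosed k] (θ : O →+* k)
    (C : Scheme.{0}) (f : C ⟶ Spec (.of O)) [IsProper f] [Flat f] (Ck : Scheme.{0}) (i : Ck ⟶ C) (t : Ck ⟶ Spec (.of k))
    (hθ : Function.Surjective θ) (hreg : Resolution.Scheme.IsRegular C)
    (hsq : IsPullback i t f (Spec.map (CommRingCat.ofHom θ)))
    (hP1 : ∃ (k' : Type) (_ : Field k'), Nonempty (Ck ≅ ProjCech.PP k' 1))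
    (φ : C ⟶ ProjCech.PP O 1) (hφ : φ ≫ ProjCech.toSpec O 1 = f)
    (hinj : ∀ y : ProjCech.PP O 1, ProjCech.toSpec O 1 y = closedPoint O → (φ.base ⁻¹' {y}).Subsingleton)
    (hsurj : Set.range (i ≫ φ).base = (ProjCech.toSpec O 1).base ⁻¹' {closedPoint O}) :
    IsFinite φ := by
  haveI : IsIntegral C := isIntegral_of_isRegular O k θ C f Ck i t hθ hreg hsq hP1
  exact isFinite_of_subsingleton_closedFibre O k θ C f Ck i t hθ hreg hsq hP1 φ hφ hinj hsurj

end Summit.ResolutionOfSingularities.ResolutionOfSingularities.Cruxes.EquisingularLiftNat.F102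

end
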